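import Summits.BirchSwinnertonDyer.BirchSwinnertonDyer.Theses.ErratumRoadFive
import Literature.NumberTheory.EllipticCurves.Kato2004.AdmissibleZetaClassRealisability
import Literature.NumberTheory.EllipticCurves.Kato2004.AdmissibleZetaClassLengthInequality
import Literature.NumberTheory.EllipticCurves.Kato2004.IwasawaH2FineSelmerDualCountRankFree
import Literature.NumberTheory.EllipticCurves.MordellWeilTheoremProofs
import Literature.NumberTheory.EllipticCurves.TateModuleContinuityProofs
import Literature.NumberTheory.EllipticCurves.LeadingTerm
import Literature.NumberTheory.EllipticCurves.Rank1Residual.Typed.Basic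
import Summits.BirchSwinnertonDyer.BirchSwinnertonDyer.Theorems.ErratumRoadFiveKatoFframeS1Lambda
import Summits.BirchSwinnertonDyer.BirchSwinnertonDyer.Theorems.ErratumRoadFiveKatoFframeSplitLogMinimumTamagawa
import Summits.BirchSwinnertonDyer.BirchSwinnertonDyer.Theorems.ErratumRoadFiveKatoFframeNonsplitLogMinimum
import HarnessLib

/-!
# Route `ErratumRoadFive`, crux `EulerHalfNotRamNoInertSetAtFive` (stmt-BirchSwinnertonDyer-19715), line `kato_Fframe`
# (registered r5.5 05abfaa44061c7a0) — **THE LINE'S COMPOSITION AS A THEOREM OF THE TREE: the crux BY NAME from the four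
# printed facts of the cite stub S0 and the two integral Perrin-Riou VALUE statements S3 / S3ns, nothing else**

LEAD seat `bsd-line-er5-p1` (g10), `--supports stmt-BirchSwinnertonDyer-19715`; theorems only (no definition, no named fact, no
instance, no notation, no `sorry`). This file lifts the kernel-checked composition `KatoFframe.EulerHalfNotRamNoInertSetAtFive_of`
of the crux workfile `Cruxes/EulerHalfNotRamNoInertSetAtFive/Lines/kato_Fframe_r5.lean` (not importable) into `Theorems/`, with
every PROVED stub plugged in by name: S1Λ = `ErratumRoadFiveKatoFframeS1Lambda.katoLambdaLogBoundTamagawa` (p765646, LEAD g9),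
S2″ = `ErratumRoadFiveKatoFframeSplitLogMinimumTamagawa.tateUniformisationLogMinimumTamagawa`, S2ns =
`ErratumRoadFiveKatoFframeNonsplitLogMinimum.nonsplitLogMinimum` (width -w2). What remains are EXACTLY the registered
non-proved stubs, taken as hypotheses verbatim (the workfile's `bottomClass W p K I z₀ = layerZeroToTop W p K (I.proj 0 z₀)` and
`logOmega W p x = padicLogLocal W p (Affine.Point.map (Algebra.ofId ℚ ℚ_[p]) x)` unfolded, as in p765646):

* the four PRINTED named facts of S0 `stub_printedFactsHeld` — GZK `rank_eq_analyticRank_of_analyticRank_le_one`, Kato Thm. 12.5 (4)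
  realisability `Kato2004.exists_isAdmissibleZetaClass_of_imageContainsSL2`, F1′ `Kato2004.lengthAt_fineSelmerDual_le_of_isAdmissibleZetaClass`,
  H2Xʳ `Kato2004.exists_iwasawaH2Data_fineSelmerDual_embedding_countRankFree` (Literature `def … : Prop`, cited; this makes the
  theorem CONDITIONAL on them — `proof.conditional` in the audit, by design of the line);
* S3 `stub_integralExcZeroValue` (binder `hS3`) and S3ns `stub_integralNonsplitValue` (binder `hS3n`): the one-sided INTEGRAL
  rank-one Perrin-Riou values of the bottom layer of Kato's admissible class at a split, resp. non-split, multiplicative `p` —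
  RESEARCH statements, NOT in print (print has the rational form only: Venerucci 2016 Thm. A at split `p`, Bertolini–Darmon–Venerucci
  2022 for `p² ∤ N`; see the r5.5 workfile docstrings). They are plain hypotheses here, not named facts and not claimed.

HONEST FRAMING: nothing is closed by this file. It records, kernel-checked and importable, that crux 19715 is EQUIVALENT-IN-DIFFICULTY to
«4 cites + S3 + S3ns»: every other step of the line (Λ-TAM = S1Λ with the whole Tamagawa defect booked, the Tate-curve minima S2″/S2ns, the
graded arithmetic, the case split on the sign at `p`) is a theorem of the tree. The crux hypotheses `¬Ram`, `p ∣ ∏c_ℓ` and the inert-set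
clause are not used (the line proves the Euler half on all of X11b ∩ {p ≥ 5, ρ̄ onto} modulo its inputs). No summit statement is proved;
BSD is proved for no curve.

References: [Kato2004Asterisque] Thm. 12.4 (3), 12.5 (4) (pp. 221–222), (14.9.3), (14.14.2); [Venerucci2016] Thm. A; [BertoliniDarmonVenerucci2022]
Thm. A; [SilvermanATAEC1994] IV.9.4; [Darmon2004] Thm. 3.22.
-/

-- the summit and its single problem are both named `BirchSwinnertonDyer` (registry layout D-0017)
set_option linter.dupNamespace false
set_option autoImplicit false

noncomputable section

open scoped Classical
open Field WeierstrassCurve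
open Literature.NumberTheory.GaloisRepresentations
open Literature.NumberTheory.EllipticCurves Literature.NumberTheory.EllipticCurves.Kato2004
open Literature.NumberTheory.EllipticCurves.Kato2004.EulerSystemValues
open Literature.NumberTheory.EllipticCurves.Rank1Residual
open Literature.NumberTheory.EllipticCurves.Rank1Residual.Typed
open Summit.BirchSwinnertonDyer.Rank1Residual
open Summit.BirchSwinnertonDyer.BirchSwinnertonDyer.Theses.ErratumRoadFive

namespace Summit.BirchSwinnertonDyer.BirchSwinnertonDyer.Theorems.ErratumRoadFiveKatoFframeClosure

/-! ## §1 Graded bottom-layer arithmetic (pure `ℤ`; the workfile's §2 lemmas) -/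

/-- The split branch: a bound `hB` carrying the booked defect `(ctot − c) + m` on the left (S1Λ), the local minimum
`hQ : vQ = 1 − c + m` (S2″) and the C⁺ value `hC` (S3) give `sha ≤ vq`; no sign condition on `ctot − c`. -/
theorem sha_le_of_doorTwoGraded (sha vx vQ vt vq ctot c m vtors : ℤ)
    (hB : sha + vx - vQ + ((ctot - c) + m) ≤ vt - vx) (hQ : vQ = 1 - c + m)
    (hC : vt - 2 * vx ≤ vq + ctot - 2 * vtors - 1) (htors : 0 ≤ vtors) :
    sha ≤ vq := by
  omega

/-- The non-split branch (`c = 0`, `m = 0`): `hB` = S1Λ at `m = 0`, `Q₀ = 0` with its defect term rewritten to `ctot` by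
S2ns (`hd`), `hQ : vQ = 1` = S2ns, `hC` = S3ns. -/
theorem sha_le_of_nonsplitChain (sha vx vQ vt vq ctot vtors d : ℤ)
    (hB : sha + vx - vQ + d ≤ vt - vx) (hd : d = ctot) (hQ : vQ = 1)
    (hC : vt - 2 * vx ≤ vq + ctot - 2 * vtors - 1) (htors : 0 ≤ vtors) :
    sha ≤ vq := by
  omega

/-! ## §2 The composition with six inputs (the workfile's `EulerHalfNotRamNoInertSetAtFive_of`, concluding the crux BY NAME) -/

/-- **`EulerHalfNotRamNoInertSetAtFive` from six inputs**: `hF` = GZK ∧ Kato 12.5 (4) realisability (named facts), `hS1` = the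
Λ-TAM bound S1Λ (a theorem of the tree modulo S0's facts, see §3), `hS2`/`hS2n` = the Tate-curve minima S2″/S2ns (theorems of the
tree, see §3), `hS3`/`hS3n` = the integral Perrin-Riou values at split / non-split `p` (research hypotheses). GZK gives rank one and a
Mordell–Weil generator (`exists_isMordellWeilBasis_holds`), Kato 12.5 (4) an admissible class (`exists_datum_of_hasSurjectiveModNGaloisRep`);
on `p` split multiplicative: S3 the value, S2″ the Tamagawa identity and the graded local witnesses `(m, Q₀, Q)`, S1Λ the bound,
`sha_le_of_doorTwoGraded`; on `p` non-split (multiplicative by X11b): S3ns, S2ns, S1Λ at `m = 0`, `Q₀ = 0`, `sha_le_of_nonsplitChain`.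
The workfile's proof verbatim with `bottomClass`/`logOmega` unfolded. [cite: Kato2004Asterisque, Thm. 12.5 (4) (p. 222)] [cite: Darmon2004, Thm. 3.22] -/
theorem eulerHalfNotRamNoInertSetAtFive_of_bound_of_minima_of_values
    (hF : rank_eq_analyticRank_of_analyticRank_le_one ∧ exists_isAdmissibleZetaClass_of_imageContainsSL2)
    (hS1 : ∀ (W : WeierstrassCurve ℚ) [W.IsElliptic] [W.IsGloballyMinimal] (p : ℕ) [Fact p.Prime]
      [ContinuousSMul ℤ_[p] (W.tateModule p)],
      5 ≤ p → Surj W p → W.analyticRank = 1 → W.HasMultiplicativeReductionAtPrime p →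
      ∀ (h1 : W.mordellWeilRank = 1) (P : Fin W.mordellWeilRank → W.toAffine.Point),
        W.IsMordellWeilBasis P →
      ∀ (K : ZpExtension ℚ p) (hK : K.IsCyclotomic) (γ : absoluteGaloisGroup ℚ)
        (I : IwasawaH1Data W p K γ) (z₀ : I.H), K.IsTopGenerator γ → IsAdmissibleZetaClass W p K hK I z₀ →
      ∀ t : ℚ_[p], HasLocPKummerLog W p (layerZeroToTop W p K (I.proj 0 z₀)) t → t ≠ 0 →
      ∀ (m : ℕ) (Q₀ : (W.baseChange ℚ_[p]).toAffine.Point), addOrderOf Q₀ = p ^ m →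
      ∀ Q : (W.baseChange ℚ_[p]).toAffine.Point, padicLogLocal W p Q ≠ 0 →
        (padicValNat p W.shaOrder : ℤ) +
              (padicLogLocal W p (WeierstrassCurve.Affine.Point.map (Algebra.ofId ℚ ℚ_[p]) (P (Fin.cast h1.symm 0)))).valuation
            - (padicLogLocal W p Q).valuation
            + (((padicValNat p W.tamagawaProduct : ℤ)
                - padicValNat p ((W.baseChange ℚ_[p]).localTamagawaNumber ℤ_[p])) + m) ≤
          t.valuation -
            (padicLogLocal W p (WeierstrassCurve.Affine.Point.map (Algebra.ofId ℚ ℚ_[p]) (P (Fin.cast h1.symm 0)))).valuation)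
    (hS2 : ∀ (W : WeierstrassCurve ℚ) [W.IsElliptic] [W.IsGloballyMinimal] (p : ℕ) [Fact p.Prime],
      5 ≤ p → W.HasSplitMultiplicativeReductionAtPrime p →
      (W.baseChange ℚ_[p]).localTamagawaNumber ℤ_[p] = padicValInt p W.minimalDiscriminantInt ∧
      ∃ (m : ℕ) (Q₀ Q : (W.baseChange ℚ_[p]).toAffine.Point), addOrderOf Q₀ = p ^ m ∧
        padicLogLocal W p Q ≠ 0 ∧
        (padicLogLocal W p Q).valuation =
          1 - (padicValNat p (padicValInt p W.minimalDiscriminantInt) : ℤ) + m)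
    (hS2n : ∀ (W : WeierstrassCurve ℚ) [W.IsElliptic] [W.IsGloballyMinimal] (p : ℕ) [Fact p.Prime],
      5 ≤ p → W.HasMultiplicativeReductionAtPrime p → ¬ W.HasSplitMultiplicativeReductionAtPrime p →
      padicValNat p ((W.baseChange ℚ_[p]).localTamagawaNumber ℤ_[p]) = 0 ∧
      ∃ Q : (W.baseChange ℚ_[p]).toAffine.Point, padicLogLocal W p Q ≠ 0 ∧
        (padicLogLocal W p Q).valuation = 1)
    (hS3 : ∀ (W : WeierstrassCurve ℚ) [W.IsElliptic] [W.IsGloballyMinimal] (p : ℕ) [Fact p.Prime]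
      [ContinuousSMul ℤ_[p] (W.tateModule p)],
      ClassX11b W p → 5 ≤ p → Surj W p → W.HasSplitMultiplicativeReductionAtPrime p →
      ∀ (h1 : W.mordellWeilRank = 1) (P : Fin W.mordellWeilRank → W.toAffine.Point),
        W.IsMordellWeilBasis P →
      ∀ (K : ZpExtension ℚ p) (hK : K.IsCyclotomic) (γ : absoluteGaloisGroup ℚ)
        (I : IwasawaH1Data W p K γ) (z₀ : I.H), K.IsTopGenerator γ → IsAdmissibleZetaClass W p K hK I z₀ →
      ∃ (q : ℚ) (t : ℚ_[p]), shaAn W = (q : ℂ) ∧ HasLocPKummerLog W p (layerZeroToTop W p K (I.proj 0 z₀)) t ∧ t ≠ 0 ∧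
        t.valuation -
            2 * (padicLogLocal W p (WeierstrassCurve.Affine.Point.map (Algebra.ofId ℚ ℚ_[p]) (P (Fin.cast h1.symm 0)))).valuation ≤
          padicValRat p q + padicValNat p W.tamagawaProduct - 2 * padicValNat p W.torsionOrder - 1)
    (hS3n : ∀ (W : WeierstrassCurve ℚ) [W.IsElliptic] [W.IsGloballyMinimal] (p : ℕ) [Fact p.Prime]
      [ContinuousSMul ℤ_[p] (W.tateModule p)],
      ClassX11b W p → 5 ≤ p → Surj W p → ¬ W.HasSplitMultiplicativeReductionAtPrime p →
      ∀ (h1 : W.mordellWeilRank = 1) (P : Fin W.mordellWeilRank → W.toAffine.Point),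
        W.IsMordellWeilBasis P →
      ∀ (K : ZpExtension ℚ p) (hK : K.IsCyclotomic) (γ : absoluteGaloisGroup ℚ)
        (I : IwasawaH1Data W p K γ) (z₀ : I.H), K.IsTopGenerator γ → IsAdmissibleZetaClass W p K hK I z₀ →
      ∃ (q : ℚ) (t : ℚ_[p]), shaAn W = (q : ℂ) ∧ HasLocPKummerLog W p (layerZeroToTop W p K (I.proj 0 z₀)) t ∧ t ≠ 0 ∧
        t.valuation -
            2 * (padicLogLocal W p (WeierstrassCurve.Affine.Point.map (Algebra.ofId ℚ ℚ_[p]) (P (Fin.cast h1.symm 0)))).valuation ≤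
          padicValRat p q + padicValNat p W.tamagawaProduct - 2 * padicValNat p W.torsionOrder - 1) :
    EulerHalfNotRamNoInertSetAtFive := by
  intro W _ _ p _ hX h5 hSurj _hnRam _hTam _hNoS
  haveI : ContinuousSMul ℤ_[p] (W.tateModule p) := TateModule.continuousSMul_padicInt
  have hr1 : W.analyticRank = 1 := hX.1
  have hmult : W.HasMultiplicativeReductionAtPrime p := hX.2.2.1
  have hmw : W.mordellWeilRank = 1 := by
    have h := (hF.1 W (le_of_eq hr1)).1
    omega
  obtain ⟨P, hP⟩ := W.exists_isMordellWeilBasis_holds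
  obtain ⟨K, hK, γ, I, z₀, hγ, hz⟩ := hF.2.exists_datum_of_hasSurjectiveModNGaloisRep W p h5 hSurj
  by_cases hsplit : W.HasSplitMultiplicativeReductionAtPrime p
  · obtain ⟨q, t, hq, ht, ht0, hC⟩ := hS3 W p hX h5 hSurj hsplit hmw P hP K hK γ I z₀ hγ hz
    obtain ⟨hcp, m, Q₀, Q, hQ₀, hQ0, hQv⟩ := hS2 W p h5 hsplit
    refine ⟨q, hq, ?_⟩
    have hB := hS1 W p h5 hSurj hr1 hmult hmw P hP K hK γ I z₀ hγ hz t ht ht0 m Q₀ hQ₀ Q hQ0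
    rw [hcp] at hB
    exact sha_le_of_doorTwoGraded _ _ _ _ _ _ _ _ _ hB hQv hC (by positivity)
  · obtain ⟨q, t, hq, ht, ht0, hC⟩ := hS3n W p hX h5 hSurj hsplit hmw P hP K hK γ I z₀ hγ hz
    obtain ⟨hc0, Q, hQ0, hQv⟩ := hS2n W p h5 hmult hsplit
    refine ⟨q, hq, ?_⟩
    have hB := hS1 W p h5 hSurj hr1 hmult hmw P hP K hK γ I z₀ hγ hz t ht ht0 0 0 (by simp) Q hQ0
    exact sha_le_of_nonsplitChain _ _ _ _ _ _ _ _ hB (by rw [hc0]; simp) hQv hC (by positivity)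

/-! ## §3 The closure: the crux BY NAME ⟸ four printed facts ∧ S3 ∧ S3ns (everything else PROVED in the tree) -/

/-- **Crux 19715 modulo exactly its registered non-proved inputs.** `ErratumRoadFive.EulerHalfNotRamNoInertSetAtFive` follows from
the four PRINTED facts of the cite stub S0 — GZK (`hGZK`), Kato Thm. 12.5 (4) realisability (`hReal`), Kato Thm. 12.5 (4) length
inequality in fine form F1′ (`hF1`), Kato (14.9.3)+(14.14.2) rank-free count H2Xʳ (`hH2X`) — together with the two integral rank-one
Perrin-Riou VALUE statements S3 (`hS3`, split multiplicative `p`: the exceptional-zero value) and S3ns (`hS3n`, non-split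
multiplicative `p`), both RESEARCH (not in print; rational forms: Venerucci 2016 Thm. A, Bertolini–Darmon–Venerucci 2022 Thm. A).
The Λ-TAM bound S1Λ is `ErratumRoadFiveKatoFframeS1Lambda.katoLambdaLogBoundTamagawa hGZK hF1 hH2X` (p765646) and the Tate-curve
minima S2″/S2ns are `ErratumRoadFiveKatoFframeSplitLogMinimumTamagawa.tateUniformisationLogMinimumTamagawa` /
`ErratumRoadFiveKatoFframeNonsplitLogMinimum.nonsplitLogMinimum`. CONDITIONAL on the four named facts (by design of the line) and on
the two research hypotheses; closes nothing. [cite: Kato2004Asterisque, Thm. 12.4 (3), Thm. 12.5 (4) with (12.5.1)–(12.5.2) (pp. 221–222), (14.9.3) (p. 240), (14.14.2) (p. 243)]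
[cite: Venerucci2016, Thm. A] [cite: BertoliniDarmonVenerucci2022, Thm. A] [cite: SilvermanATAEC1994, IV.9.4 (Tate's algorithm, Step 2)]
[cite: Darmon2004, Thm. 3.22] -/
theorem eulerHalfNotRamNoInertSetAtFive_of_printedFacts_of_integralValues
    (hGZK : rank_eq_analyticRank_of_analyticRank_le_one)
    (hReal : exists_isAdmissibleZetaClass_of_imageContainsSL2)
    (hF1 : lengthAt_fineSelmerDual_le_of_isAdmissibleZetaClass)
    (hH2X : exists_iwasawaH2Data_fineSelmerDual_embedding_countRankFree)
    (hS3 : ∀ (W : WeierstrassCurve ℚ) [W.IsElliptic] [W.IsGloballyMinimal] (p : ℕ) [Fact p.Prime]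
      [ContinuousSMul ℤ_[p] (W.tateModule p)],
      ClassX11b W p → 5 ≤ p → Surj W p → W.HasSplitMultiplicativeReductionAtPrime p →
      ∀ (h1 : W.mordellWeilRank = 1) (P : Fin W.mordellWeilRank → W.toAffine.Point),
        W.IsMordellWeilBasis P →
      ∀ (K : ZpExtension ℚ p) (hK : K.IsCyclotomic) (γ : absoluteGaloisGroup ℚ)
        (I : IwasawaH1Data W p K γ) (z₀ : I.H), K.IsTopGenerator γ → IsAdmissibleZetaClass W p K hK I z₀ →
      ∃ (q : ℚ) (t : ℚ_[p]), shaAn W = (q : ℂ) ∧ HasLocPKummerLog W p (layerZeroToTop W p K (I.proj 0 z₀)) t ∧ t ≠ 0 ∧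
        t.valuation -
            2 * (padicLogLocal W p (WeierstrassCurve.Affine.Point.map (Algebra.ofId ℚ ℚ_[p]) (P (Fin.cast h1.symm 0)))).valuation ≤
          padicValRat p q + padicValNat p W.tamagawaProduct - 2 * padicValNat p W.torsionOrder - 1)
    (hS3n : ∀ (W : WeierstrassCurve ℚ) [W.IsElliptic] [W.IsGloballyMinimal] (p : ℕ) [Fact p.Prime]
      [ContinuousSMul ℤ_[p] (W.tateModule p)],
      ClassX11b W p → 5 ≤ p → Surj W p → ¬ W.HasSplitMultiplicativeReductionAtPrime p →
      ∀ (h1 : W.mordellWeilRank = 1) (P : Fin W.mordellWeilRank → W.toAffine.Point),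
        W.IsMordellWeilBasis P →
      ∀ (K : ZpExtension ℚ p) (hK : K.IsCyclotomic) (γ : absoluteGaloisGroup ℚ)
        (I : IwasawaH1Data W p K γ) (z₀ : I.H), K.IsTopGenerator γ → IsAdmissibleZetaClass W p K hK I z₀ →
      ∃ (q : ℚ) (t : ℚ_[p]), shaAn W = (q : ℂ) ∧ HasLocPKummerLog W p (layerZeroToTop W p K (I.proj 0 z₀)) t ∧ t ≠ 0 ∧
        t.valuation -
            2 * (padicLogLocal W p (WeierstrassCurve.Affine.Point.map (Algebra.ofId ℚ ℚ_[p]) (P (Fin.cast h1.symm 0)))).valuation ≤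
          padicValRat p q + padicValNat p W.tamagawaProduct - 2 * padicValNat p W.torsionOrder - 1) :
    EulerHalfNotRamNoInertSetAtFive :=
  eulerHalfNotRamNoInertSetAtFive_of_bound_of_minima_of_values ⟨hGZK, hReal⟩
    (ErratumRoadFiveKatoFframeS1Lambda.katoLambdaLogBoundTamagawa hGZK hF1 hH2X)
    ErratumRoadFiveKatoFframeSplitLogMinimumTamagawa.tateUniformisationLogMinimumTamagawa
    ErratumRoadFiveKatoFframeNonsplitLogMinimum.nonsplitLogMinimum hS3 hS3n

/-! ## §4 (appended, LEAD g10) The same inputs give the Euler half on ALL of X11b ∩ {p ≥ 5, ρ̄ onto}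

The composition never touches the crux's residual hypotheses `¬Ram W p`, `p ∣ ∏ c_ℓ` and the inert-set clause: recorded here
as theorems with the STRONGER, class-wide conclusion `ClassX11b W p → 5 ≤ p → Surj W p → Typed.MissingUpperBoundAt W p` (so the
same six inputs serve every X11b item of the route at `p ≥ 5` with `ρ̄` onto, not only 19715). Same proof, binder for binder. -/

/-- **The Euler half `Typed.MissingUpperBoundAt W p` on ALL of X11b ∩ {p ≥ 5, ρ̄ onto} from the six inputs** (`hF` = GZK ∧
Kato 12.5 (4) realisability, `hS1` = S1Λ, `hS2`/`hS2n` = S2″/S2ns, `hS3`/`hS3n` = the integral Perrin-Riou values): the body of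
`eulerHalfNotRamNoInertSetAtFive_of_bound_of_minima_of_values` verbatim, without introducing (and discarding) the three residual
hypotheses of the crux. [cite: Kato2004Asterisque, Thm. 12.5 (4) (p. 222)] [cite: Darmon2004, Thm. 3.22] -/
theorem missingUpperBoundAt_of_bound_of_minima_of_values
    (hF : rank_eq_analyticRank_of_analyticRank_le_one ∧ exists_isAdmissibleZetaClass_of_imageContainsSL2)
    (hS1 : ∀ (W : WeierstrassCurve ℚ) [W.IsElliptic] [W.IsGloballyMinimal] (p : ℕ) [Fact p.Prime]
      [ContinuousSMul ℤ_[p] (W.tateModule p)],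
      5 ≤ p → Surj W p → W.analyticRank = 1 → W.HasMultiplicativeReductionAtPrime p →
      ∀ (h1 : W.mordellWeilRank = 1) (P : Fin W.mordellWeilRank → W.toAffine.Point),
        W.IsMordellWeilBasis P →
      ∀ (K : ZpExtension ℚ p) (hK : K.IsCyclotomic) (γ : absoluteGaloisGroup ℚ)
        (I : IwasawaH1Data W p K γ) (z₀ : I.H), K.IsTopGenerator γ → IsAdmissibleZetaClass W p K hK I z₀ →
      ∀ t : ℚ_[p], HasLocPKummerLog W p (layerZeroToTop W p K (I.proj 0 z₀)) t → t ≠ 0 →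
      ∀ (m : ℕ) (Q₀ : (W.baseChange ℚ_[p]).toAffine.Point), addOrderOf Q₀ = p ^ m →
      ∀ Q : (W.baseChange ℚ_[p]).toAffine.Point, padicLogLocal W p Q ≠ 0 →
        (padicValNat p W.shaOrder : ℤ) +
              (padicLogLocal W p (WeierstrassCurve.Affine.Point.map (Algebra.ofId ℚ ℚ_[p]) (P (Fin.cast h1.symm 0)))).valuation
            - (padicLogLocal W p Q).valuation
            + (((padicValNat p W.tamagawaProduct : ℤ)
                - padicValNat p ((W.baseChange ℚ_[p]).localTamagawaNumber ℤ_[p])) + m) ≤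
          t.valuation -
            (padicLogLocal W p (WeierstrassCurve.Affine.Point.map (Algebra.ofId ℚ ℚ_[p]) (P (Fin.cast h1.symm 0)))).valuation)
    (hS2 : ∀ (W : WeierstrassCurve ℚ) [W.IsElliptic] [W.IsGloballyMinimal] (p : ℕ) [Fact p.Prime],
      5 ≤ p → W.HasSplitMultiplicativeReductionAtPrime p →
      (W.baseChange ℚ_[p]).localTamagawaNumber ℤ_[p] = padicValInt p W.minimalDiscriminantInt ∧
      ∃ (m : ℕ) (Q₀ Q : (W.baseChange ℚ_[p]).toAffine.Point), addOrderOf Q₀ = p ^ m ∧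
        padicLogLocal W p Q ≠ 0 ∧
        (padicLogLocal W p Q).valuation =
          1 - (padicValNat p (padicValInt p W.minimalDiscriminantInt) : ℤ) + m)
    (hS2n : ∀ (W : WeierstrassCurve ℚ) [W.IsElliptic] [W.IsGloballyMinimal] (p : ℕ) [Fact p.Prime],
      5 ≤ p → W.HasMultiplicativeReductionAtPrime p → ¬ W.HasSplitMultiplicativeReductionAtPrime p →
      padicValNat p ((W.baseChange ℚ_[p]).localTamagawaNumber ℤ_[p]) = 0 ∧
      ∃ Q : (W.baseChange ℚ_[p]).toAffine.Point, padicLogLocal W p Q ≠ 0 ∧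
        (padicLogLocal W p Q).valuation = 1)
    (hS3 : ∀ (W : WeierstrassCurve ℚ) [W.IsElliptic] [W.IsGloballyMinimal] (p : ℕ) [Fact p.Prime]
      [ContinuousSMul ℤ_[p] (W.tateModule p)],
      ClassX11b W p → 5 ≤ p → Surj W p → W.HasSplitMultiplicativeReductionAtPrime p →
      ∀ (h1 : W.mordellWeilRank = 1) (P : Fin W.mordellWeilRank → W.toAffine.Point),
        W.IsMordellWeilBasis P →
      ∀ (K : ZpExtension ℚ p) (hK : K.IsCyclotomic) (γ : absoluteGaloisGroup ℚ)
        (I : IwasawaH1Data W p K γ) (z₀ : I.H), K.IsTopGenerator γ → IsAdmissibleZetaClass W p K hK I z₀ →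
      ∃ (q : ℚ) (t : ℚ_[p]), shaAn W = (q : ℂ) ∧ HasLocPKummerLog W p (layerZeroToTop W p K (I.proj 0 z₀)) t ∧ t ≠ 0 ∧
        t.valuation -
            2 * (padicLogLocal W p (WeierstrassCurve.Affine.Point.map (Algebra.ofId ℚ ℚ_[p]) (P (Fin.cast h1.symm 0)))).valuation ≤
          padicValRat p q + padicValNat p W.tamagawaProduct - 2 * padicValNat p W.torsionOrder - 1)
    (hS3n : ∀ (W : WeierstrassCurve ℚ) [W.IsElliptic] [W.IsGloballyMinimal] (p : ℕ) [Fact p.Prime]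
      [ContinuousSMul ℤ_[p] (W.tateModule p)],
      ClassX11b W p → 5 ≤ p → Surj W p → ¬ W.HasSplitMultiplicativeReductionAtPrime p →
      ∀ (h1 : W.mordellWeilRank = 1) (P : Fin W.mordellWeilRank → W.toAffine.Point),
        W.IsMordellWeilBasis P →
      ∀ (K : ZpExtension ℚ p) (hK : K.IsCyclotomic) (γ : absoluteGaloisGroup ℚ)
        (I : IwasawaH1Data W p K γ) (z₀ : I.H), K.IsTopGenerator γ → IsAdmissibleZetaClass W p K hK I z₀ →
      ∃ (q : ℚ) (t : ℚ_[p]), shaAn W = (q : ℂ) ∧ HasLocPKummerLog W p (layerZeroToTop W p K (I.proj 0 z₀)) t ∧ t ≠ 0 ∧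
        t.valuation -
            2 * (padicLogLocal W p (WeierstrassCurve.Affine.Point.map (Algebra.ofId ℚ ℚ_[p]) (P (Fin.cast h1.symm 0)))).valuation ≤
          padicValRat p q + padicValNat p W.tamagawaProduct - 2 * padicValNat p W.torsionOrder - 1) :
    ∀ (W : WeierstrassCurve ℚ) [W.IsElliptic] [W.IsGloballyMinimal] (p : ℕ) [Fact p.Prime],
      ClassX11b W p → 5 ≤ p → Surj W p → MissingUpperBoundAt W p := by
  intro W _ _ p _ hX h5 hSurj
  haveI : ContinuousSMul ℤ_[p] (W.tateModule p) := TateModule.continuousSMul_padicInt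
  have hr1 : W.analyticRank = 1 := hX.1
  have hmult : W.HasMultiplicativeReductionAtPrime p := hX.2.2.1
  have hmw : W.mordellWeilRank = 1 := by
    have h := (hF.1 W (le_of_eq hr1)).1
    omega
  obtain ⟨P, hP⟩ := W.exists_isMordellWeilBasis_holds
  obtain ⟨K, hK, γ, I, z₀, hγ, hz⟩ := hF.2.exists_datum_of_hasSurjectiveModNGaloisRep W p h5 hSurj
  by_cases hsplit : W.HasSplitMultiplicativeReductionAtPrime p
  · obtain ⟨q, t, hq, ht, ht0, hC⟩ := hS3 W p hX h5 hSurj hsplit hmw P hP K hK γ I z₀ hγ hz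
    obtain ⟨hcp, m, Q₀, Q, hQ₀, hQ0, hQv⟩ := hS2 W p h5 hsplit
    refine ⟨q, hq, ?_⟩
    have hB := hS1 W p h5 hSurj hr1 hmult hmw P hP K hK γ I z₀ hγ hz t ht ht0 m Q₀ hQ₀ Q hQ0
    rw [hcp] at hB
    exact sha_le_of_doorTwoGraded _ _ _ _ _ _ _ _ _ hB hQv hC (by positivity)
  · obtain ⟨q, t, hq, ht, ht0, hC⟩ := hS3n W p hX h5 hSurj hsplit hmw P hP K hK γ I z₀ hγ hz
    obtain ⟨hc0, Q, hQ0, hQv⟩ := hS2n W p h5 hmult hsplit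
    refine ⟨q, hq, ?_⟩
    have hB := hS1 W p h5 hSurj hr1 hmult hmw P hP K hK γ I z₀ hγ hz t ht ht0 0 0 (by simp) Q hQ0
    exact sha_le_of_nonsplitChain _ _ _ _ _ _ _ _ hB (by rw [hc0]; simp) hQv hC (by positivity)

/-- **The Euler half on ALL of X11b ∩ {p ≥ 5, ρ̄ onto} modulo the four printed facts of S0 and the two integral values
S3 / S3ns** — the class-wide form of `eulerHalfNotRamNoInertSetAtFive_of_printedFacts_of_integralValues` (same inputs; S1Λ =
p765646, S2″/S2ns = the width files). CONDITIONAL on the four named facts and the two research hypotheses; closes nothing.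
[cite: Kato2004Asterisque, Thm. 12.4 (3), Thm. 12.5 (4) (pp. 221–222), (14.9.3) (p. 240), (14.14.2) (p. 243)]
[cite: Venerucci2016, Thm. A] [cite: BertoliniDarmonVenerucci2022, Thm. A] [cite: Darmon2004, Thm. 3.22] -/
theorem missingUpperBoundAt_of_printedFacts_of_integralValues
    (hGZK : rank_eq_analyticRank_of_analyticRank_le_one)
    (hReal : exists_isAdmissibleZetaClass_of_imageContainsSL2)
    (hF1 : lengthAt_fineSelmerDual_le_of_isAdmissibleZetaClass)
    (hH2X : exists_iwasawaH2Data_fineSelmerDual_embedding_countRankFree)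
    (hS3 : ∀ (W : WeierstrassCurve ℚ) [W.IsElliptic] [W.IsGloballyMinimal] (p : ℕ) [Fact p.Prime]
      [ContinuousSMul ℤ_[p] (W.tateModule p)],
      ClassX11b W p → 5 ≤ p → Surj W p → W.HasSplitMultiplicativeReductionAtPrime p →
      ∀ (h1 : W.mordellWeilRank = 1) (P : Fin W.mordellWeilRank → W.toAffine.Point),
        W.IsMordellWeilBasis P →
      ∀ (K : ZpExtension ℚ p) (hK : K.IsCyclotomic) (γ : absoluteGaloisGroup ℚ)
        (I : IwasawaH1Data W p K γ) (z₀ : I.H), K.IsTopGenerator γ → IsAdmissibleZetaClass W p K hK I z₀ →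
      ∃ (q : ℚ) (t : ℚ_[p]), shaAn W = (q : ℂ) ∧ HasLocPKummerLog W p (layerZeroToTop W p K (I.proj 0 z₀)) t ∧ t ≠ 0 ∧
        t.valuation -
            2 * (padicLogLocal W p (WeierstrassCurve.Affine.Point.map (Algebra.ofId ℚ ℚ_[p]) (P (Fin.cast h1.symm 0)))).valuation ≤
          padicValRat p q + padicValNat p W.tamagawaProduct - 2 * padicValNat p W.torsionOrder - 1)
    (hS3n : ∀ (W : WeierstrassCurve ℚ) [W.IsElliptic] [W.IsGloballyMinimal] (p : ℕ) [Fact p.Prime]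
      [ContinuousSMul ℤ_[p] (W.tateModule p)],
      ClassX11b W p → 5 ≤ p → Surj W p → ¬ W.HasSplitMultiplicativeReductionAtPrime p →
      ∀ (h1 : W.mordellWeilRank = 1) (P : Fin W.mordellWeilRank → W.toAffine.Point),
        W.IsMordellWeilBasis P →
      ∀ (K : ZpExtension ℚ p) (hK : K.IsCyclotomic) (γ : absoluteGaloisGroup ℚ)
        (I : IwasawaH1Data W p K γ) (z₀ : I.H), K.IsTopGenerator γ → IsAdmissibleZetaClass W p K hK I z₀ →
      ∃ (q : ℚ) (t : ℚ_[p]), shaAn W = (q : ℂ) ∧ HasLocPKummerLog W p (layerZeroToTop W p K (I.proj 0 z₀)) t ∧ t ≠ 0 ∧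
        t.valuation -
            2 * (padicLogLocal W p (WeierstrassCurve.Affine.Point.map (Algebra.ofId ℚ ℚ_[p]) (P (Fin.cast h1.symm 0)))).valuation ≤
          padicValRat p q + padicValNat p W.tamagawaProduct - 2 * padicValNat p W.torsionOrder - 1) :
    ∀ (W : WeierstrassCurve ℚ) [W.IsElliptic] [W.IsGloballyMinimal] (p : ℕ) [Fact p.Prime],
      ClassX11b W p → 5 ≤ p → Surj W p → MissingUpperBoundAt W p :=
  missingUpperBoundAt_of_bound_of_minima_of_values ⟨hGZK, hReal⟩
    (ErratumRoadFiveKatoFframeS1Lambda.katoLambdaLogBoundTamagawa hGZK hF1 hH2X)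
    ErratumRoadFiveKatoFframeSplitLogMinimumTamagawa.tateUniformisationLogMinimumTamagawa
    ErratumRoadFiveKatoFframeNonsplitLogMinimum.nonsplitLogMinimum hS3 hS3n

end Summit.BirchSwinnertonDyer.BirchSwinnertonDyer.Theorems.ErratumRoadFiveKatoFframeClosure

end
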